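import Summits.HodgeConjecture.HodgeConjecture.Theses.NikulinTwinTransport
import Literature.AlgebraicGeometry.HodgeTheory.LefschetzOneOneChowProofs

/-!
# Route NikulinTwinTransport — `LefschetzOneOneK3` (item stmt-HodgeConjecture-13678): reductions

The route item `LefschetzOneOneK3` is Lefschetz's theorem on `(1,1)`-classes for projective K3
surfaces, on the real carriers of the layer `Literature/AlgebraicGeometry/HodgeTheory`: for every
`S` satisfying the K3 clause (smooth projective surface, `H¹(S, 𝒪_S) = 0`, a Hodge model with a
nowhere-vanishing `2`-form holomorphic in charts), every rational class `c ∈ H²(S(ℂ); ℂ)` of Hodge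
type `(1,1)` lies in `algebraicClasses S 1 = N¹ H²(S(ℂ); ℂ)`.

It is, symbol for symbol, the `n = 2` / K3 slice of the named fact
`Literature.AlgebraicGeometry.HodgeTheory.lefschetzOneOne_rational` (Voisin I, Thm. 11.30 with
Cor. 11.34 and §11.3.3), which is undischarged in the tree. This helper file records, against the
route decl BY NAME,

* the one-line closures from each of the three statements of the tree that contain it
  (`lefschetzOneOne_rational`, `hodgeClasses_algebraic_of_dim_le_three`, the Hodge conjecture for
  smooth projective surfaces), and
* the K3-LOCAL forms of the tree's proved reductions of `lefschetzOneOne_rational`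
  (`lefschetzOneOne_rational_of`, `lefschetzOneOne_integral_vanishing_of_chernWeil`,
  `isTrivialOn_compl_analyticSet_of_globalSections`, `lefschetzOneOne_chernWeil_of_rigidity`), in
  which the analytic inputs — the integral vanishing form of Thm. 11.30 / Cor. 11.34, or the
  Chern–Weil heart (Thm. 11.30 with Thm. 7.10 (i)) together with the meromorphic-section lemma
  (Kodaira–Serre) — are required ONLY on Hodge models of the K3 surface at hand (dimension `2`),
  Chow's theorem, universal coefficients, the local exactness of the Chern form and the pull-back
  calculus being the tree's discharged theorems.

So the item closes the day the analytic heart of Lefschetz `(1,1)` is proved for surfaces; nothing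
K3-specific (the holomorphic `2`-form, `H¹(𝒪) = 0`) shortens that heart.
-/

noncomputable section

open scoped Manifold ContDiff
open CategoryTheory
open Literature.AlgebraicTopology.SingularHomology
open Literature.AlgebraicGeometry
open Literature.AlgebraicGeometry.HodgeTheory
open Literature.Geometry.Kaehler (HolomorphicLineBundle MForm IsSmoothForm IsClosedForm mextDeriv
  IsAnalyticSet)
open Literature.NumberTheory.Transcendental (ComplexDeRhamIsoFamily complexDeRhamCohomology
  cclosedSmoothForms csmoothForms cexactSmoothForms mem_cclosedSmoothForms mem_csmoothForms_iff
  PullbackFacts)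

namespace Summit.HodgeConjecture.HodgeConjecture.Theorems

open Summit.HodgeConjecture.HodgeConjecture.Theses.NikulinTwinTransport

/-! ### The item is a slice of three statements of the tree -/

/-- `LefschetzOneOneK3` is the K3 slice of the named fact `lefschetzOneOne_rational` (Voisin I,
Thm. 11.30, Cor. 11.34, §11.3.3): instantiate it at `n = 2` with the first conjunct of the K3
clause. -/
theorem lefschetzOneOneK3_of_lefschetzOneOne_rational (h : lefschetzOneOne_rational) :
    LefschetzOneOneK3 := by
  unfold LefschetzOneOneK3
  intro S hS c hc h11
  exact h hS.1 c hc h11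

/-- `LefschetzOneOneK3` is also the `p = 1` slice at `n = 2 ≤ 3` of the named fact
`hodgeClasses_algebraic_of_dim_le_three` (the Hodge conjecture in every degree for smooth projective
varieties of dimension `≤ 3`, Voisin II, proof of Prop. 10.26). -/
theorem lefschetzOneOneK3_of_hodgeClasses_algebraic_of_dim_le_three
    (h : hodgeClasses_algebraic_of_dim_le_three) : LefschetzOneOneK3 := by
  unfold LefschetzOneOneK3
  intro S hS c hc h11
  exact h (by norm_num) hS.1 1 c hc h11

/-- `LefschetzOneOneK3` is the degree-`2` part of the Hodge conjecture for smooth projective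
surfaces, in the summit layer's spelling `HodgeConjectureFor 2 S`. -/
theorem lefschetzOneOneK3_of_hodgeConjectureFor_two
    (h : ∀ ⦃S : Motives.SchemeOver ℂ⦄, Motives.IsSmoothProjective 2 S →
      Literature.AlgebraicGeometry.HodgeTheory.HodgeConjectureFor 2 S) :
    LefschetzOneOneK3 := by
  unfold LefschetzOneOneK3
  intro S hS c hc h11
  exact (h hS.1).2 1 c hc h11

/-! ### Pointwise assembly on one smooth projective surface -/

/-- **Pointwise form of the tree's assembly `lefschetzOneOne_rational_of`, with Chow's theorem and
universal coefficients discharged.** For ONE smooth projective surface `S`: if on every Hodge model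
`A` of `S` every integral class `β ∈ H²(A.carrier; ℂ)` lying in `H^{1,1} = A.hodgePQ 2 1 1`
restricts to `0` off some proper closed analytic subset (the integral vanishing form of Voisin I,
Thm. 11.30 with Cor. 11.34, required at `S` only), then every rational class of type `(1,1)` in
`H²(S(ℂ); ℂ)` lies in `algebraicClasses S 1`. Proof as in `lefschetzOneOne_rational_of`: clear
denominators (`exists_nsmul_isIntegralClass_of_isRationalClass_holds`), pull back to the model,
apply the hypothesis, turn the analytic subset into a Zariski-closed one
(`chow_analyticSet_analytification_holds`), and conclude with
`mem_supportedClasses_of_restrictCompl_eq_zero`. -/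
theorem mem_algebraicClasses_one_of_integral_vanishing_at {S : Motives.SchemeOver ℂ}
    (hS : Motives.IsSmoothProjective 2 S)
    (h₁ : ∀ (A : HodgeModel 2 S) (β : singularCohomology ℂ ℂ A.carrier (2 * 1)),
      IsIntegralClass β → β ∈ A.hodgePQ (2 * 1) 1 1 →
        ∃ T : Set A.carrier, IsAnalyticSet 𝓘(ℂ, A.model) T ∧ T ≠ Set.univ ∧
          singularCohomology.map ℂ ℂ
            (⟨Subtype.val, continuous_subtype_val⟩ : C({m : A.carrier // m ∉ T}, A.carrier))
            (2 * 1) β = 0)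
    (c : complexBetti S (2 * 1)) (hc : IsRationalClass c) (h11 : IsOfHodgeType 2 S (2 * 1) 1 1 c) :
    c ∈ algebraicClasses S 1 := by
  -- adapted from `Literature.AlgebraicGeometry.HodgeTheory.lefschetzOneOne_rational_of`
  obtain ⟨A, hA⟩ := h11
  obtain ⟨N, hN, hNc⟩ := exists_nsmul_isIntegralClass_of_isRationalClass_holds hS (2 * 1) c hc
  -- the pull-back of `N • c` to the model is integral and of type `(1,1)`
  have hβint : IsIntegralClass (A.pullback (2 * 1) ((N : ℂ) • c)) := hNc.map _
  have hβ11 : A.pullback (2 * 1) ((N : ℂ) • c) ∈ A.hodgePQ (2 * 1) 1 1 := by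
    rw [map_smul]
    exact Submodule.smul_mem _ _ hA
  -- hypothesis: it dies off a proper closed analytic subset `T`; Chow: `T = φ⁻¹(Z(ℂ))`
  obtain ⟨T, hT, hTne, hβT⟩ := h₁ A _ hβint hβ11
  obtain ⟨Z, hZc, hTZ⟩ := chow_analyticSet_analytification_holds hS A.isAnalytification T hT
  have hZne : Z ≠ Set.univ := by
    rintro rfl
    refine hTne ?_
    rw [hTZ]
    exact Set.eq_univ_of_forall fun m ↦ Set.mem_univ _
  -- `Z` is a proper closed subset of the integral scheme `S`: codimension `≥ 1` everywhere
  haveI : AlgebraicGeometry.IsIntegral S.left := Motives.IsSmoothProjective.isIntegral_holds hS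
  have hcodim : ∀ z ∈ Z, ((1 : ℕ) : ℕ∞) ≤ Order.coheight z := fun z hz ↦
    one_le_coheight_of_mem_of_isClosed_of_ne_univ hZc hZne hz
  -- `N • c`, hence `c`, dies on `(S ∖ Z)(ℂ)`
  have hNres : complexBetti.restrictCompl S Z (2 * 1) ((N : ℂ) • c) = 0 :=
    restrictCompl_eq_zero_of_pullback A hTZ _ hβT
  have hN' : (N : ℂ) ≠ 0 := by exact_mod_cast hN.ne'
  have hres : complexBetti.restrictCompl S Z (2 * 1) c = 0 := by
    have hc' : c = (N : ℂ)⁻¹ • ((N : ℂ) • c) := by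
      rw [smul_smul, inv_mul_cancel₀ hN', one_smul]
    rw [hc', map_smul, hNres, smul_zero]
  exact mem_supportedClasses_of_restrictCompl_eq_zero hZc hcodim hres

/-- **`LefschetzOneOneK3` from the integral vanishing form of Thm. 11.30 / Cor. 11.34 on Hodge
models of K3 surfaces only** (the hypothesis `h₁` of `lefschetzOneOne_rational_of` restricted to
dimension `2` and to the surfaces of the item). -/
theorem lefschetzOneOneK3_of_integral_vanishing
    (h₁ : ∀ ⦃S : Motives.SchemeOver ℂ⦄,
      (Motives.IsSmoothProjective 2 S ∧ Subsingleton (Motives.structureSheafCohomology S.left 1) ∧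
        ∃ (A : HodgeModel 2 S) (η : MForm 𝓘(ℝ, A.model) A.carrier ℂ 2),
          Literature.Geometry.Kaehler.IsHolomorphicInCharts η ∧ ∀ x, η x ≠ 0) →
      ∀ (A : HodgeModel 2 S) (β : singularCohomology ℂ ℂ A.carrier (2 * 1)),
        IsIntegralClass β → β ∈ A.hodgePQ (2 * 1) 1 1 →
          ∃ T : Set A.carrier, IsAnalyticSet 𝓘(ℂ, A.model) T ∧ T ≠ Set.univ ∧
            singularCohomology.map ℂ ℂ
              (⟨Subtype.val, continuous_subtype_val⟩ : C({m : A.carrier // m ∉ T}, A.carrier))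
              (2 * 1) β = 0) :
    LefschetzOneOneK3 := by
  unfold LefschetzOneOneK3
  intro S hS c hc h11
  exact mem_algebraicClasses_one_of_integral_vanishing_at hS.1 (h₁ hS) c hc h11

/-! ### Pointwise Chern–Weil reduction on one Hodge model -/

/-- **Pointwise form of the tree's assembly `lefschetzOneOne_integral_vanishing_of_chernWeil`, with
the local exactness of the Chern form and the pull-back calculus discharged.** For ONE Hodge model
`A` (of anything): if every integral class `β ∈ H²(A.carrier; ℂ)` in `A.hodgePQ 2 1 1` is
`μ • A.deRham[θ]` for the Chern form `θ` of some Hermitian holomorphic line bundle presented by a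
cocycle (the Chern–Weil heart, Voisin I Thm. 11.30 with Thm. 7.10 (i), AT `A`), and if every such
line bundle on `A.carrier` is trivial off a proper closed analytic subset (the meromorphic-section
lemma of Cor. 11.34, AT `A`), then every integral `(1,1)`-class on `A.carrier` restricts to `0` off
a proper closed analytic subset. Proof as in the tree: `θ|_W = dη` on `W = A.carrier ∖ T`
(`chernForm_exact_of_isTrivialOn_holds`), so `[θ]|_W = 0`, and `A.deRham` is natural along
`W ↪ A.carrier`. -/
theorem integral_vanishing_of_chernWeil_at {n : ℕ} {S : Motives.SchemeOver ℂ} (A : HodgeModel n S)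
    (h₁ : ∀ (β : singularCohomology ℂ ℂ A.carrier 2), IsIntegralClass β → β ∈ A.hodgePQ 2 1 1 →
      ∃ (ι : Type) (L : HolomorphicLineBundle ι A.model A.carrier) (h : L.HermitianMetric)
        (θ : MForm 𝓘(ℝ, A.model) A.carrier ℂ 2) (hs : IsSmoothForm θ) (hc : IsClosedForm θ),
        h.IsChernForm θ ∧ ∃ μ : ℂ,
          β = μ • A.deRham A.carrier 2
            (complexDeRhamCohomology.mk A.model A.carrier 2 ⟨θ, mem_cclosedSmoothForms hs hc⟩))
    (h₂ : ∀ (ι : Type) (L : HolomorphicLineBundle ι A.model A.carrier),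
      ∃ T : Set A.carrier, IsAnalyticSet 𝓘(ℂ, A.model) T ∧ T ≠ Set.univ ∧ L.IsTrivialOn Tᶜ)
    (β : singularCohomology ℂ ℂ A.carrier (2 * 1)) (hβi : IsIntegralClass β)
    (hβ11 : β ∈ A.hodgePQ (2 * 1) 1 1) :
    ∃ T : Set A.carrier, IsAnalyticSet 𝓘(ℂ, A.model) T ∧ T ≠ Set.univ ∧
      singularCohomology.map ℂ ℂ
        (⟨Subtype.val, continuous_subtype_val⟩ : C({m : A.carrier // m ∉ T}, A.carrier))
        (2 * 1) β = 0 := by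
  -- adapted from `Literature.AlgebraicGeometry.HodgeTheory.lefschetzOneOne_integral_vanishing_of_chernWeil`
  obtain ⟨ι, L, h, θ, hs, hc, hθ, μ, hβ⟩ := h₁ β hβi hβ11
  obtain ⟨T, hT, hTne, htriv⟩ := h₂ ι L
  refine ⟨T, hT, hTne, ?_⟩
  -- the open submanifold `W = A.carrier ∖ T`, on which the Chern form is exact
  let W : TopologicalSpace.Opens A.carrier := ⟨Tᶜ, hT.isClosed.isOpen_compl⟩
  obtain ⟨η, hη, hdη⟩ := chernForm_exact_of_isTrivialOn_holds L h θ hs hθ W htriv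
  haveI : SigmaCompactSpace W := A.sigmaCompactSpace_opens W
  have hval : ContMDiff 𝓘(ℝ, A.model) 𝓘(ℝ, A.model) ∞ (Subtype.val : W → A.carrier) :=
    contMDiff_subtype_val
  -- the de Rham class of `θ` dies on `W`
  set c : complexDeRhamCohomology A.model A.carrier 2 :=
    complexDeRhamCohomology.mk A.model A.carrier 2 ⟨θ, mem_cclosedSmoothForms hs hc⟩ with hc_def
  have hexact : θ.pullback 𝓘(ℝ, A.model) (Subtype.val : W → A.carrier) ∈
      cexactSmoothForms A.model W 2 := by
    rw [← hdη]
    exact Submodule.subset_span ⟨η, (mem_csmoothForms_iff η).2 hη, rfl⟩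
  have hres : complexDeRhamCohomology.map A.model hval 2 c = 0 := by
    rw [hc_def, complexDeRhamCohomology.map_mk, ← (complexDeRhamCohomology.mk A.model W 2).map_zero,
      complexDeRhamCohomology.mk_eq_mk_iff, Submodule.coe_zero, sub_zero]
    exact hexact
  -- naturality of the comparison along `W ↪ A.carrier`
  have hnat := A.deRham_isNatural W A.carrier Subtype.val hval 2 c
  rw [hres, map_zero] at hnat
  have key : singularCohomology.map ℂ ℂ
      (⟨Subtype.val, continuous_subtype_val⟩ : C({m : A.carrier // m ∉ T}, A.carrier)) (2 * 1)
        (A.deRham A.carrier 2 c) = 0 :=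
    hnat.symm
  rw [hβ, map_smul, key, smul_zero]

/-- **The printed argument `σ = σ₁/σ₂` of Cor. 11.34, pointwise**: on a Hodge model `A` of a smooth
projective variety, a cocycle line bundle `L` admitting non-zero global sections `σ₁` of `L ⊗ L'`
and `σ₂` of `L'` for some cocycle line bundle `L'` is trivial off the proper closed analytic subset
`{σ₁ = 0} ∪ {σ₂ = 0}` (proper because the carrier is connected). As in the tree's
`isTrivialOn_compl_analyticSet_of_globalSections`. -/
theorem isTrivialOn_compl_analyticSet_of_globalSections_at {n : ℕ} {S : Motives.SchemeOver ℂ}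
    (hS : Motives.IsSmoothProjective n S) (A : HodgeModel n S) (ι : Type)
    (L : HolomorphicLineBundle ι A.model A.carrier)
    (h : ∃ (κ : Type) (L' : HolomorphicLineBundle κ A.model A.carrier)
      (σ₁ : (L.tensor L').GlobalSection) (σ₂ : L'.GlobalSection),
      σ₁.zeroSet ≠ Set.univ ∧ σ₂.zeroSet ≠ Set.univ) :
    ∃ T : Set A.carrier, IsAnalyticSet 𝓘(ℂ, A.model) T ∧ T ≠ Set.univ ∧ L.IsTrivialOn Tᶜ := by
  obtain ⟨κ, L', σ₁, σ₂, hσ₁, hσ₂⟩ := h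
  haveI := A.connectedSpace_carrier hS
  exact ⟨σ₁.zeroSet ∪ σ₂.zeroSet, σ₁.isAnalyticSet_zeroSet.union σ₂.isAnalyticSet_zeroSet,
    σ₁.zeroSet_union_zeroSet_ne_univ σ₂ hσ₁ hσ₂,
    HolomorphicLineBundle.isTrivialOn_compl_zeroSet_union σ₁ σ₂⟩

/-- **`LefschetzOneOneK3` from exactly the two printed analytic inputs of Voisin I, required on Hodge
models of K3 surfaces only**: the Chern–Weil heart (Thm. 11.30 with Thm. 7.10 (i): an integral
`(1,1)`-class is `μ • A.deRham[θ]` for a Chern form `θ`) and the Kodaira–Serre input of the proof of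
Cor. 11.34 (every cocycle line bundle `L` has some `L'` with non-zero sections of `L ⊗ L'` and of
`L'`). Everything downstream (the quotient `σ₁/σ₂`, exactness of the Chern form where the bundle is
trivial, naturality, Chow's theorem, universal coefficients, codimension of proper closed subsets
of an integral scheme) is proved in the tree. -/
theorem lefschetzOneOneK3_of_chernWeil_of_globalSections
    (h₁ : ∀ ⦃S : Motives.SchemeOver ℂ⦄,
      (Motives.IsSmoothProjective 2 S ∧ Subsingleton (Motives.structureSheafCohomology S.left 1) ∧
        ∃ (A : HodgeModel 2 S) (η : MForm 𝓘(ℝ, A.model) A.carrier ℂ 2),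
          Literature.Geometry.Kaehler.IsHolomorphicInCharts η ∧ ∀ x, η x ≠ 0) →
      ∀ (A : HodgeModel 2 S) (β : singularCohomology ℂ ℂ A.carrier 2),
        IsIntegralClass β → β ∈ A.hodgePQ 2 1 1 →
          ∃ (ι : Type) (L : HolomorphicLineBundle ι A.model A.carrier) (h : L.HermitianMetric)
            (θ : MForm 𝓘(ℝ, A.model) A.carrier ℂ 2) (hs : IsSmoothForm θ) (hc : IsClosedForm θ),
            h.IsChernForm θ ∧ ∃ μ : ℂ,
              β = μ • A.deRham A.carrier 2
                (complexDeRhamCohomology.mk A.model A.carrier 2 ⟨θ, mem_cclosedSmoothForms hs hc⟩))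
    (h₂ : ∀ ⦃S : Motives.SchemeOver ℂ⦄,
      (Motives.IsSmoothProjective 2 S ∧ Subsingleton (Motives.structureSheafCohomology S.left 1) ∧
        ∃ (A : HodgeModel 2 S) (η : MForm 𝓘(ℝ, A.model) A.carrier ℂ 2),
          Literature.Geometry.Kaehler.IsHolomorphicInCharts η ∧ ∀ x, η x ≠ 0) →
      ∀ (A : HodgeModel 2 S) (ι : Type) (L : HolomorphicLineBundle ι A.model A.carrier),
        ∃ (κ : Type) (L' : HolomorphicLineBundle κ A.model A.carrier)
          (σ₁ : (L.tensor L').GlobalSection) (σ₂ : L'.GlobalSection),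
          σ₁.zeroSet ≠ Set.univ ∧ σ₂.zeroSet ≠ Set.univ) :
    LefschetzOneOneK3 := by
  refine lefschetzOneOneK3_of_integral_vanishing fun S hS A β hβi hβ11 ↦ ?_
  exact integral_vanishing_of_chernWeil_at A (h₁ hS A)
    (fun ι L ↦ isTrivialOn_compl_analyticSet_of_globalSections_at hS.1 A ι L (h₂ hS A ι L))
    β hβi hβ11

/-! ### The rigidity line, K3-local -/

/-- **`LefschetzOneOneK3` from the rigidity of natural de Rham comparisons, the printed theorem for
ONE natural comparison family per model space (`ComplexDeRhamIsoFamily.IsLefschetzOneOne`, de Rham's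
integration comparison: Thm. 11.30 + Thm. 7.10 (i) with no scalar), and the Kodaira–Serre sections
on Hodge models of K3 surfaces** — the tree's `lefschetzOneOne_chernWeil_of_rigidity` (with the
pull-back calculus discharged by `instPullbackFacts`) feeding the K3-local Chern–Weil reduction. -/
theorem lefschetzOneOneK3_of_rigidity_of_globalSections (hR : NaturalDeRhamComparisonRigidity)
    (h₁ : ∀ (E : Type) [NormedAddCommGroup E] [NormedSpace ℂ E] [FiniteDimensional ℂ E],
      ∃ e₀ : ComplexDeRhamIsoFamily E, e₀.IsNatural ∧ e₀.IsLefschetzOneOne)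
    (h₂ : ∀ ⦃S : Motives.SchemeOver ℂ⦄,
      (Motives.IsSmoothProjective 2 S ∧ Subsingleton (Motives.structureSheafCohomology S.left 1) ∧
        ∃ (A : HodgeModel 2 S) (η : MForm 𝓘(ℝ, A.model) A.carrier ℂ 2),
          Literature.Geometry.Kaehler.IsHolomorphicInCharts η ∧ ∀ x, η x ≠ 0) →
      ∀ (A : HodgeModel 2 S) (ι : Type) (L : HolomorphicLineBundle ι A.model A.carrier),
        ∃ (κ : Type) (L' : HolomorphicLineBundle κ A.model A.carrier)
          (σ₁ : (L.tensor L').GlobalSection) (σ₂ : L'.GlobalSection),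
          σ₁.zeroSet ≠ Set.univ ∧ σ₂.zeroSet ≠ Set.univ) :
    LefschetzOneOneK3 :=
  lefschetzOneOneK3_of_chernWeil_of_globalSections
    (fun _S hS A β hβi hβ11 ↦ lefschetzOneOne_chernWeil_of_rigidity hR h₁
      (fun _E _ _ _ _E' _ _ _ _M _ _ _ _N _ _ _ ↦ inferInstance) hS.1 A β hβi hβ11)
    h₂

end Summit.HodgeConjecture.HodgeConjecture.Theorems

end
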